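import Summits.QuantumFields.YangMills.Theorems.LuscherReductionRunningReductionKTDefs
import Summits.QuantumFields.YangMills.Theorems.FemtoTransferGapSlabRayleigh
import HarnessLib

/-!
# Crux RED `RunningReduction`, line «KT»: the physical subspace as a real vector space carrying `l2`, `K_β` and `K_β²`
# — the operator-free dictionary for the tree's cluster Kato–Temple bound

Support module for crux `RunningReduction` (route `LuscherReduction`, item stmt-QuantumFields-19978), line «KT» (owner ym-beyond-p1 g16;
stubs `stub_katoTempleDoor` (M∕L), `stub_dressedRitz` (XL∕L)).  The Literature engine `ClusterKatoTempleBound.lean` (lit g8: `clusterKatoTemple_op`,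
`clusterKatoTemple_of_forall_gt`, `residualGram_le_of_variance`, `exists_orthonormal_formDiagonal_antitone`, …) is written for a real vector
space `D`, a symmetric positive semidefinite bilinear form `ip`, and an `ip`-symmetric operator `K`.  This file supplies EXACTLY that data
for the femto transfer problem at fixed lattice (`SU(2)`, every `L ≥ 1`), so that `KatoTempleDoor` becomes an instantiation:

* `physSubmodule L` — the `ℝ`-submodule of physical zero-flux test functions (`IsPhys`, closed under `+`, `•`; `IsPhys.add∕smul`);
* `l2Form L : physSubmodule L →ₗ physSubmodule L →ₗ ℝ` — the `L²` pairing as a bilinear form (`l2Form_symm`, `l2Form_self_nonneg`);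
* `transferApply_add`, `transferApply_smul` — linearity of `K_β` on bounded measurable functions; **`transferOp β : physSubmodule L →ₗ[ℝ]
  physSubmodule L`** — the transfer operator as a linear endomorphism of the physical subspace (`isPhys_transferApply`);
* the dictionary: `l2Form ψ (transferOp β φ) = qform su2Rep β ψ φ`, `l2Form (transferOp β ψ) (transferOp β φ) = qform2 β ψ φ`,
  `transferOp_symm` (`ip (K x) y = ip x (K y)`), `l2Form_self_transferOp_nonneg` (`β ≥ 0`).

HONEST FRAMING: femto rung R2b1, fixed-lattice functional analysis; nothing here bears on infinite volume or the Clay gap.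
References: M. Reed, B. Simon IV (1978) XIII.1–2; T. Kato, J. Phys. Soc. Japan 4 (1949) [cite: Kato1949].
-/

set_option autoImplicit false

noncomputable section

open MeasureTheory Filter Topology Real
open Literature.MathematicalPhysics.QuantumFieldTheory
open Literature.MathematicalPhysics.QuantumLattice
open Literature.Analysis.OperatorTheory.YMMatrixModel

namespace Summit.QuantumFields.YangMills.Theorems.FemtoTransferGap

/-! ### §1. The physical subspace and the `L²` form -/

/-- **The real vector space of physical zero-flux test functions** of the fine `(ℤ/L)³` theory (`SU(2)`). [cite: Luscher1983] -/
def physSubmodule (L : ℕ) : Submodule ℝ (GaugeConfig 3 L SU2 → ℝ) where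
  carrier := {ψ | IsPhys ψ}
  zero_mem' := isPhys_const 0
  add_mem' := fun hψ hφ => hψ.add hφ
  smul_mem' := fun c _ hψ => hψ.smul c

/-- Membership in the physical subspace is `IsPhys`. [folklore] -/
theorem mem_physSubmodule {L : ℕ} {ψ : GaugeConfig 3 L SU2 → ℝ} : ψ ∈ physSubmodule L ↔ IsPhys ψ := Iff.rfl

/-- Elements of the physical subspace are physical. [folklore] -/
theorem isPhys_coe {L : ℕ} (ψ : physSubmodule L) : IsPhys (ψ : GaugeConfig 3 L SU2 → ℝ) := ψ.2

variable (L : ℕ) [NeZero L]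

/-- **The `L²` pairing as a bilinear form on the physical subspace.** [cite: ReedSimonIV1978, XIII.1–2] -/
def l2Form : physSubmodule L →ₗ[ℝ] physSubmodule L →ₗ[ℝ] ℝ :=
  LinearMap.mk₂ ℝ (fun ψ φ : physSubmodule L => l2 (ψ : GaugeConfig 3 L SU2 → ℝ) φ)
    (fun ψ₁ ψ₂ φ => by
      simp only [Submodule.coe_add]
      exact l2_add_left (isPhys_coe ψ₁) (isPhys_coe ψ₂) (isPhys_coe φ))
    (fun c ψ φ => by
      simp only [Submodule.coe_smul, smul_eq_mul]
      exact l2_smul_left c _ _)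
    (fun ψ φ₁ φ₂ => by
      simp only [Submodule.coe_add]
      rw [l2_comm, l2_add_left (isPhys_coe φ₁) (isPhys_coe φ₂) (isPhys_coe ψ),
        l2_comm (φ₁ : GaugeConfig 3 L SU2 → ℝ), l2_comm (φ₂ : GaugeConfig 3 L SU2 → ℝ)])
    (fun c ψ φ => by
      simp only [Submodule.coe_smul, smul_eq_mul]
      rw [l2_comm, l2_smul_left, l2_comm])

variable {L}

/-- `l2Form` unfolded. [folklore] -/
@[simp] theorem l2Form_apply (ψ φ : physSubmodule L) : l2Form L ψ φ = l2 (ψ : GaugeConfig 3 L SU2 → ℝ) φ := rfl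

/-- `l2Form` is symmetric. [folklore] -/
theorem l2Form_symm (ψ φ : physSubmodule L) : l2Form L ψ φ = l2Form L φ ψ := by
  rw [l2Form_apply, l2Form_apply, l2_comm]

/-- `l2Form` is positive semidefinite. [folklore] -/
theorem l2Form_self_nonneg (ψ : physSubmodule L) : 0 ≤ l2Form L ψ ψ := l2_self_nonneg _

/-! ### §2. Linearity of the transfer operator; `K_β` as an endomorphism of the physical subspace -/

/-- `K_β` is additive on physical test functions. [folklore] -/
theorem transferApply_add (β : ℝ) {ψ φ : GaugeConfig 3 L SU2 → ℝ} (hψ : IsPhys ψ) (hφ : IsPhys φ) :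
    transferApply β (ψ + φ) = transferApply β ψ + transferApply β φ := by
  obtain ⟨C, hC⟩ := hψ.bounded
  obtain ⟨D, hD⟩ := hφ.bounded
  funext U
  simp only [transferApply_apply, Pi.add_apply, mul_add]
  exact integral_add (integrable_transferKernel_mul β U hψ.measurable hC) (integrable_transferKernel_mul β U hφ.measurable hD)

/-- `K_β` is homogeneous. [folklore] -/
theorem transferApply_smul (β c : ℝ) (ψ : GaugeConfig 3 L SU2 → ℝ) : transferApply β (c • ψ) = c • transferApply β ψ := by
  funext U
  simp only [transferApply_apply, Pi.smul_apply, smul_eq_mul]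
  rw [← integral_const_mul]
  exact integral_congr_ae (ae_of_all _ fun V => by ring)

/-- **The transfer operator as a linear endomorphism of the physical subspace** (`isPhys_transferApply`). [cite: Luscher1983] -/
def transferOp (β : ℝ) : physSubmodule L →ₗ[ℝ] physSubmodule L where
  toFun ψ := ⟨transferApply β ψ, isPhys_transferApply β ψ.2⟩
  map_add' ψ φ := by
    apply Subtype.ext
    simp only [Submodule.coe_add]
    exact transferApply_add β ψ.2 φ.2
  map_smul' c ψ := by
    apply Subtype.ext
    simp only [Submodule.coe_smul, RingHom.id_apply]
    exact transferApply_smul β c _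

/-- `transferOp` unfolded. [folklore] -/
@[simp] theorem coe_transferOp (β : ℝ) (ψ : physSubmodule L) :
    ((transferOp β ψ : physSubmodule L) : GaugeConfig 3 L SU2 → ℝ) = transferApply β ψ := rfl

/-! ### §3. The dictionary `(ip, K) ↔ (l2, qform, qform2)` -/

/-- `ip x (K y) = ⟨x, K_β y⟩ = qform x y`. [cite: ReedSimonIV1978, XIII.1–2] -/
theorem l2Form_transferOp_right (β : ℝ) (ψ φ : physSubmodule L) :
    l2Form L ψ (transferOp β φ) = qform su2Rep β (ψ : GaugeConfig 3 L SU2 → ℝ) φ := by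
  rw [l2Form_apply, coe_transferOp, qform_eq_l2_transferApply]

/-- **`K_β` is `ip`-symmetric**: `ip (K x) y = ip x (K y)`. [cite: SeilerLNP1982, §3] -/
theorem transferOp_symm (β : ℝ) (ψ φ : physSubmodule L) :
    l2Form L (transferOp β ψ) φ = l2Form L ψ (transferOp β φ) := by
  rw [l2Form_apply, l2Form_apply, coe_transferOp, coe_transferOp, l2_transferApply_comm β (isPhys_coe ψ) (isPhys_coe φ)]

/-- `ip (K x) (K y) = qform2 x y` (the two-step form). [cite: ReedSimonIV1978, XIII.1–2] -/
theorem l2Form_transferOp_transferOp (β : ℝ) (ψ φ : physSubmodule L) :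
    l2Form L (transferOp β ψ) (transferOp β φ) = qform2 β (ψ : GaugeConfig 3 L SU2 → ℝ) φ := by
  rw [l2Form_apply, coe_transferOp, coe_transferOp]
  rfl

/-- `ip x (K x) ≥ 0` for `β ≥ 0` (positive semi-definiteness of the transfer form). [cite: OsterwalderSeiler1978, §2] -/
theorem l2Form_self_transferOp_nonneg {β : ℝ} (hβ : 0 ≤ β) (ψ : physSubmodule L) : 0 ≤ l2Form L ψ (transferOp β ψ) := by
  rw [l2Form_transferOp_right]
  exact qform_su2Rep_self_nonneg hβ (isPhys_coe ψ)

/-- `ip (K x) (K x) · ip x x − (ip x (K x))²` is the variance clause of `DressedRitz`∕`KatoTempleDoor` read through the dictionary. [folklore] -/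
theorem variance_dictionary (β : ℝ) (ψ : physSubmodule L) :
    l2Form L (transferOp β ψ) (transferOp β ψ) * l2Form L ψ ψ - l2Form L ψ (transferOp β ψ) ^ 2 =
      qform2 β (ψ : GaugeConfig 3 L SU2 → ℝ) ψ * l2 (ψ : GaugeConfig 3 L SU2 → ℝ) ψ -
        qform su2Rep β (ψ : GaugeConfig 3 L SU2 → ℝ) ψ ^ 2 := by
  rw [l2Form_transferOp_transferOp, l2Form_apply, l2Form_transferOp_right]

end Summit.QuantumFields.YangMills.Theorems.FemtoTransferGap

end
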